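import Mathlib
import HarnessLib
import Literature.Combinatorics.Additive.SumsetVersusDifferenceSet
import Literature.Combinatorics.Additive.QuasiProgressions

/-!
# Grynkiewicz 2009, §6, CASE I, Subcase 3 (`|B(e)| = 1`) of the proof of Theorem 4.1

[cite: Grynkiewicz2009, §6, Subcase 3 (proof of Thm 4.1, pp. 31–32)] [tag: critical-pair] [tag: inverse-theorem]

Topic `Literature/Combinatorics/Additive`.  Cell `mm-stpp` (D-0046), seat `mm-stpp-lit` (gen 24); the
port of D. J. Grynkiewicz, *A step beyond Kemperman's structure theorem*, Mathematika **55** (2009)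
67–114 continued.  After Claim 5 (`StepBeyondKempermanClaimFive.lean`, `conclusion_of_deepCore`) what
remains of Theorem 4.1 for finite `G` is the deep core (Claims 9–11, Subcases 1–4, print pp. 28–34).
This file is the first piece of it: **Subcase 3 is impossible**.

THE PRINTED SETTING (p. 29).  With `|A| ≥ |B| ≥ 4` (Claim 9) and `|A + B| = |A| + |B|`, «we can choose
`e ∈ A − B` such that `|(e + B) ∩ A|` is maximal subject to `|(e + B) ∩ A| < |B|` … Let
`B(e) = (e + B) ∩ A`».  Subcase 3 is `|B(e)| = 1`; by the maximality of `e` this says exactly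
«`|(x + B) ∩ A| ≤ 1` for all `x ∈ G ∖ T`», where «`T` [is] the subset of `A − B` such that `T + B ⊆ A`»
(p. 31), and THIS is the hypothesis `hmax` below (no normalisation `e = 0` is needed).

THE PRINTED PROOF (pp. 31–32) and how it is mirrored here.
* «Thus we can apply Theorem 3.1 with `k = 1`» — the tree's `SumsetVersusDifferenceSet.lean`
  (`thm31_iii`, hypothesis form `addConvolution_neg_le_of_card_inter_vadd_le`).
* «Let `A′ = A ∖ (T + B)` … every element `a′ + b`, for `a′ ∈ A′` and `b ∈ B`, is a unique expression
  element in `A + B`.  Hence `|A + B| ≥ |A′||B| + |(A ∖ A′) + B| ≥ …`, … it follows that `|A′| ≤ 1`»: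
  `eq_of_notMem_tset_add`, `card_sdiff_tset_add_le_one`.
* «As a result, since `d⊆(A, QP) ≥ 2` (eq. (47)), it follows that `T + B` is aperiodic» — here already
  «`A` is not quasi-periodic» (Claim 4) suffices, since `A = (T + B) ∪ A′` with `|A′| ≤ 1` would be a
  quasi-periodic decomposition: `addStab_eq_of_card_sdiff_le_one` (used again for `T + 2B`).
* «Suppose `r_{B,−B}(b) ≥ 2` for some nonzero `b`. … `{0, b} + T = T` … `T` is periodic, contradicting
  that `T + B` is aperiodic. … Consequently, `B` is a Sidon set and `|2B| = |B|(|B| + 1)/2`»: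
  `sidon_of_tset` (we read off `b + T = T` directly instead of quoting Kneser's Theorem for it) and the
  tree's `card_mul_succ_le_two_mul_card_add_of_sidon` (`|B|(|B| + 1) ≤ 2|2B|`, the half actually used).
* «Since `|A′| ≤ 1`, … `T + 2B = (A ∖ α) + B`.  Hence, since `|N₁ᵃ(B, A)| ≤ 1` for all `a ∈ A`
  (Claim 8), it follows that `T + 2B = (A + B) ∖ γ` … Thus `A + B` not quasi-periodic (eq. (45)) implies
  that `T + 2B` is aperiodic»: `card_add_sdiff_erase_add_le_one` + `addStab_eq_of_card_sdiff_le_one`.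
* The end.  Print: (57) (Thm 3.1 (ii)) ⟹ `|T| ≥ 2` and (58) `|T| ≥ |A| − |B| − 1`; Kneser's Theorem on
  the aperiodic `T + 2B` forces equality in (58); then (59)–(60) locate the printed `x` of Thm 3.1 (iii)
  (`x = (|B| + 1)(|B| − 1)|B|`, i.e. the level `(M + x)/|A||B| = |B| − 1`) and (iii) gives `|B| ≤ 1`.
  DEVIATION (shorter road, same ingredients): the tree's `thm31_iii` holds at EVERY level, and at the
  level `d = |B| − 1` it reads `|B|(|B| − 1)(|A| − |B| − |T|) ≤ 0`, i.e. `|T| ≥ |A| − |B|` outright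
  (stronger than (58)); the print's Kneser step `|A| + |B| ≥ |T + 2B| ≥ |T| + |2B| − 1` is then already
  contradictory for `|B| ≥ 4`.  So (57)–(60) are not transcribed; `T ≠ ∅` (print: from `|T| ≥ 2`) comes
  for free from `|A′| ≤ 1` and `|A| ≥ 4`.

MAIN STATEMENT: `subcaseThree_false` — for finite `A, B` in an abelian group with `|A| ≥ |B| ≥ 4`,
`|A + B| = |A| + |B|`, every translate `x + B ⊄ A` meeting `A` in at most one point, `A` and `A + B` not
quasi-periodic, and `|N₁ᵃ(B, A)| ≤ 1` for all `a ∈ A`: `False`.  (No finiteness of `G` is used.)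

WHAT THIS FILE IS NOT: no new definitions, no named facts; nothing of Subcases 1, 2, 4 or of the
induction; the standing assumptions (45), (47), Claim 8, Claim 9 enter as hypotheses in the tree's
vocabulary (`IsQuasiPeriodic`, `layerWith`), exactly as they stand in the binder of the hypothesis `deep`
of `Grynkiewicz2009.conclusion_of_deepCore`.

## References
* D. J. Grynkiewicz, *A step beyond Kemperman's structure theorem*, Mathematika 55 (2009) 67–114,
  doi:10.1112/S0025579300000966; §6, proof of Theorem 4.1, CASE I, the choice of `e` (p. 29) and
  Subcase 3 (pp. 31–32, displays (57)–(60)); §3 Theorem 3.1 (held `paper:doi-10-1112-s0025579300000966`,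
  pp. 29, 31–32 read 2026-08-29) [cite: Grynkiewicz2009, §6 Subcase 3].
* M. Kneser, *Abschätzungen der asymptotischen Dichte von Summenmengen*, Math. Z. 58 (1953) 459–484 —
  Kneser's theorem, used as the tree's `card_add_card_le_card_add_add_card_addStab` [cite: Kneser1953].
-/

namespace Literature.Combinatorics.Additive.Grynkiewicz2009

open Finset
open scoped Pointwise

variable {G : Type*} [AddCommGroup G] [DecidableEq G]

/-! ### Aperiodicity from «not quasi-periodic» -/

/-- If `X ⊆ Y` misses at most one element of `Y`, `X ≠ ∅`, and `Y` is not quasi-periodic, then `X` is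
aperiodic: a nontrivial period group `H` of `X` would make `Y = X ∪ (Y ∖ X)` a quasi-periodic
decomposition with nonempty periodic part (print p. 32: «since `d⊆(A, QP) ≥ 2` … `T + B` is aperiodic»
and «`A + B` not quasi-periodic (eq. (45)) implies that `T + 2B` is aperiodic»).
[cite: Grynkiewicz2009, §6 Subcase 3 (p. 32)] -/
theorem addStab_eq_of_card_sdiff_le_one {X Y : Finset G} (hXY : X ⊆ Y) (h1 : #(Y \ X) ≤ 1)
    (hX : X.Nonempty) (hY : ¬ IsQuasiPeriodic Y) : X.addStab = {0} := by
  by_contra hne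
  obtain ⟨H, hH, hHX⟩ := (isPeriodic_iff_addStab_ne hX).2 hne
  apply hY
  rw [← union_sdiff_of_subset hXY]
  refine isQuasiPeriodic_union_of_isPeriodicWith hH hHX hX fun x hx y hy => ?_
  rw [card_le_one.1 h1 x hx y hy, sub_self]
  exact H.zero_mem

/-! ### The set `T` and the unique expression elements `a′ + b` (print p. 32, first paragraph) -/

/-- «Let `a′ ∈ A′` and `a ∈ A`.  If `(a′ + B) ∩ (a + B)` is nonempty, then `a′ + b′ = a + b` for some
`b, b′ ∈ B`.  Hence `a′ ∈ (a′ − b) + B` and `a = a′ − b + b′ ∈ (a′ − b) + B`.  Hence, if `a′` and `a` are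
distinct, then `|(a′ − b + B) ∩ A| ≥ 2`, whence `a′ − b + B ⊆ A`.  Thus `a′ − b ∈ T` and `a′ ∈ T + B`, a
contradiction.  Therefore every element `a′ + b`, for `a′ ∈ A′` and `b ∈ B`, is a unique expression
element in `A + B`.»  Here `T` is any finset containing every `x` with `x + B ⊆ A`, and the maximality
of `e` is the hypothesis `hmax`. [cite: Grynkiewicz2009, §6 Subcase 3 (p. 32)] -/
theorem eq_of_notMem_tset_add {A B T : Finset G}
    (hmax : ∀ x : G, ¬ (x +ᵥ B ⊆ A) → #(A ∩ (x +ᵥ B)) ≤ 1)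
    (hT : ∀ x : G, x +ᵥ B ⊆ A → x ∈ T) {a' b' a b : G} (ha' : a' ∈ A) (ha'T : a' ∉ T + B)
    (hb' : b' ∈ B) (ha : a ∈ A) (hb : b ∈ B) (h : a + b = a' + b') : a = a' ∧ b = b' := by
  have key : a = a' := by
    by_contra hne
    have hsub : (a' - b) +ᵥ B ⊆ A := by
      by_contra hns
      have h2 : 1 < #(A ∩ ((a' - b) +ᵥ B)) := by
        rw [one_lt_card]
        refine ⟨a', mem_inter.2 ⟨ha', mem_vadd_finset.2 ⟨b, hb, ?_⟩⟩,
          a, mem_inter.2 ⟨ha, mem_vadd_finset.2 ⟨b', hb', ?_⟩⟩, Ne.symm hne⟩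
        · rw [vadd_eq_add, sub_add_cancel]
        · rw [vadd_eq_add, eq_sub_of_add_eq h]; abel
      exact absurd (hmax _ hns) (not_le.2 h2)
    exact ha'T (mem_add.2 ⟨a' - b, hT _ hsub, b, hb, sub_add_cancel a' b⟩)
  refine ⟨key, ?_⟩
  rw [key] at h
  exact add_left_cancel h

/-- «Hence `|A + B| ≥ |A′||B| + |(A ∖ A′) + B| ≥ |A| + |A′|(|B| − 1) = |A| + |B| + (|A′| − 1)(|B| − 1) − 1`.
Thus in view of `|A + B| = |A| + |B|` and `|B| ≥ 3` (Claim 9), it follows that `|A′| ≤ 1`», where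
`A′ = A ∖ (T + B)`. [cite: Grynkiewicz2009, §6 Subcase 3 (p. 32)] -/
theorem card_sdiff_tset_add_le_one {A B T : Finset G}
    (hmax : ∀ x : G, ¬ (x +ᵥ B ⊆ A) → #(A ∩ (x +ᵥ B)) ≤ 1)
    (hT : ∀ x : G, x +ᵥ B ⊆ A → x ∈ T) (hTB : T + B ⊆ A) (hB3 : 3 ≤ #B)
    (hAB : #(A + B) = #A + #B) : #(A \ (T + B)) ≤ 1 := by
  set A' := A \ (T + B) with hA'
  have hBne : B.Nonempty := card_pos.1 (by omega)
  -- `A′ + B` consists of unique expression elements: `|A′ + B| = |A′||B|`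
  have hinj : Set.InjOn (fun p : G × G => p.1 + p.2) ↑(A' ×ˢ B) := by
    rintro ⟨a₁, b₁⟩ h₁ ⟨a₂, b₂⟩ h₂ heq
    rw [mem_coe, mem_product] at h₁ h₂
    have ha₁ := mem_sdiff.1 h₁.1
    have ha₂ := mem_sdiff.1 h₂.1
    obtain ⟨e1, e2⟩ := eq_of_notMem_tset_add hmax hT ha₂.1 ha₂.2 h₂.2 ha₁.1 h₁.2 heq
    exact Prod.ext e1 e2
  have hS₁ : #(A' + B) = #A' * #B := by
    rw [← card_product, ← image_add_product]
    exact card_image_of_injOn hinj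
  -- and is disjoint from `(T + B) + B`
  have hdisj : Disjoint (A' + B) ((T + B) + B) := by
    rw [disjoint_left]
    intro c hc₁ hc₂
    obtain ⟨a', ha', b', hb', rfl⟩ := mem_add.1 hc₁
    obtain ⟨a, ha, b, hb, heq⟩ := mem_add.1 hc₂
    have ha'A := mem_sdiff.1 ha'
    obtain ⟨e1, -⟩ := eq_of_notMem_tset_add hmax hT ha'A.1 ha'A.2 hb' (hTB ha) hb heq
    rw [e1] at ha
    exact ha'A.2 ha
  have hsub : (A' + B) ∪ ((T + B) + B) ⊆ A + B :=
    union_subset (add_subset_add_right sdiff_subset) (add_subset_add_right hTB)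
  have hcard := card_le_card hsub
  rw [card_union_of_disjoint hdisj, hS₁, hAB] at hcard
  have h2 : #(T + B) ≤ #((T + B) + B) := card_le_card_add_right hBne
  have h3 : #(A \ (T + B)) + #(T + B) = #A := card_sdiff_add_card_eq_card hTB
  by_contra hn
  push Not at hn
  nlinarith [hcard, h2, h3, hn, hB3]

/-! ### `B` is a Sidon set (print p. 32, third paragraph) -/

/-- «Suppose `r_{B,−B}(b) ≥ 2` for some nonzero `b`.  Hence `|(b + t + B) ∩ (t + B)| ≥ 2` for `t ∈ T`.
Thus, since `t + B ⊆ A`, it follows that `|(b + t + B) ∩ A| ≥ 2`, whence `(b + t + B) ⊆ A`.  Consequently,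
`b + T + B ⊆ A`, whence the definition of `T` implies that `{0, b} + T = T`.  Thus … `T` is periodic,
contradicting that `T + B` is aperiodic.  So we can assume `r_{B,−B}(b) ≤ 1` for all nonzero `b`.
Consequently, `B` is a Sidon set» — in the spelled-out Sidon form of `SumsetVersusDifferenceSet`
(`b₁ + b₂ = b₃ + b₄ ⟹ b₁ = b₃ ∨ b₁ = b₄`); the periodicity of `T` is read off from `b + T = T` directly.
[cite: Grynkiewicz2009, §6 Subcase 3 (p. 32)] -/
theorem sidon_of_tset {A B T : Finset G}
    (hmax : ∀ x : G, ¬ (x +ᵥ B ⊆ A) → #(A ∩ (x +ᵥ B)) ≤ 1)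
    (hT : ∀ x : G, x +ᵥ B ⊆ A → x ∈ T) (hTsub : ∀ x ∈ T, x +ᵥ B ⊆ A) (hTne : T.Nonempty)
    (haper : (T + B).addStab = {0}) :
    ∀ b₁ ∈ B, ∀ b₂ ∈ B, ∀ b₃ ∈ B, ∀ b₄ ∈ B, b₁ + b₂ = b₃ + b₄ → b₁ = b₃ ∨ b₁ = b₄ := by
  intro b₁ hb₁ b₂ hb₂ b₃ hb₃ b₄ hb₄ h
  by_contra hnot
  push Not at hnot
  obtain ⟨h13, h14⟩ := hnot
  have h23 : b₂ ≠ b₃ := by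
    rintro rfl
    rw [add_comm] at h
    exact h14 (add_left_cancel h)
  have hBne : B.Nonempty := ⟨b₁, hb₁⟩
  set g := b₁ - b₃ with hg
  have hg0 : g ≠ 0 := fun h0 => h13 (sub_eq_zero.1 h0)
  -- `g + t ∈ T` for every `t ∈ T`
  have hshift : ∀ t ∈ T, g + t ∈ T := by
    intro t ht
    have htB := hTsub t ht
    apply hT
    by_contra hns
    have h2 : 1 < #(A ∩ ((g + t) +ᵥ B)) := by
      rw [one_lt_card]
      refine ⟨g + t + b₃, mem_inter.2 ⟨htB (mem_vadd_finset.2 ⟨b₁, hb₁, ?_⟩),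
          mem_vadd_finset.2 ⟨b₃, hb₃, rfl⟩⟩,
        g + t + b₂, mem_inter.2 ⟨htB (mem_vadd_finset.2 ⟨b₄, hb₄, ?_⟩),
          mem_vadd_finset.2 ⟨b₂, hb₂, rfl⟩⟩, fun heq => h23 (add_left_cancel heq).symm⟩
      · rw [vadd_eq_add, hg]; abel
      · have h' : b₄ = b₁ + b₂ - b₃ := by rw [h, add_sub_cancel_left]
        rw [vadd_eq_add, hg, h']; abel
    exact absurd (hmax _ hns) (not_le.2 h2)
  -- hence `g + T = T` and `g` is a period of `T + B`
  have hgT : g +ᵥ T = T := by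
    refine eq_of_subset_of_card_le (fun x hx => ?_) (card_vadd_finset g T).symm.le
    obtain ⟨t, ht, rfl⟩ := mem_vadd_finset.1 hx
    exact hshift t ht
  have hgTB : g ∈ (T + B).addStab := by
    rw [mem_addStab (hTne.add hBne), ← vadd_add_assoc, hgT]
  rw [haper, mem_singleton] at hgTB
  exact hg0 hgTB

/-! ### `T + 2B` misses at most one element of `A + B` (print p. 32, fourth paragraph) -/

/-- «… whence `T + 2B = (A ∖ α) + B`.  Hence, since `|N₁ᵃ(B, A)| ≤ 1` for all `a ∈ A` (Claim 8), it
follows that `T + 2B = (A + B) ∖ γ` for some `γ ∈ G`»: every element of `(A + B) ∖ ((A ∖ α) + B)` has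
all its expressions of the form `α + b`, so it is a unique expression element `α + b`, i.e. lies in
`N₁^α(B, A)` (the tree's `layerWith B A 1 {α}`). [cite: Grynkiewicz2009, §6 Subcase 3 (p. 32)] -/
theorem card_add_sdiff_erase_add_le_one {A B : Finset G} {α : G} (hα : α ∈ A)
    (hN1 : #(layerWith B A 1 {α}) ≤ 1) : #((A + B) \ (A.erase α + B)) ≤ 1 := by
  refine (card_le_card fun c hc => ?_).trans hN1
  rw [mem_sdiff] at hc
  obtain ⟨hcAB, hc⟩ := hc
  -- every expression `c = a + b` has `a = α`
  have honly : ∀ a ∈ A, c - a ∈ B → a = α := by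
    intro a ha hca
    by_contra hne
    exact hc (mem_add.2 ⟨a, mem_erase.2 ⟨hne, ha⟩, c - a, hca, add_sub_cancel a c⟩)
  have hcα : c - α ∈ B := by
    obtain ⟨a, ha, b, hb, rfl⟩ := mem_add.1 hcAB
    have := honly a ha (by rwa [add_sub_cancel_left])
    subst this
    rwa [add_sub_cancel_left]
  rw [mem_layerWith, one_nsmul]
  refine ⟨by rw [add_comm]; exact hcAB, eq_singleton_iff_unique_mem.2 ⟨?_, fun a ha => ?_⟩⟩
  · rw [mem_repTrace, Nat.sub_self, zero_nsmul, add_zero]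
    exact ⟨hα, hcα⟩
  · rw [mem_repTrace, Nat.sub_self, zero_nsmul, add_zero] at ha
    exact honly a ha.1 ha.2

/-! ### Subcase 3 -/

/-- **Subcase 3 (`|B(e)| = 1`) of the proof of Theorem 4.1 cannot occur** (print pp. 31–32: «Subcase 3:
`|B(e)| = 1`. Let `T` be the subset of `A − B` such that `T + B ⊆ A`.  Since `|B(e)| = 1`, the maximality
of `e` implies that `|(x + B) ∩ A| ≤ 1` for all `x ∈ G ∖ T`, which implies `r_{A,−B}(x) ≤ 1` for all
`x ∈ G ∖ T`.  Thus we can apply Theorem 3.1 with `k = 1` … which implies `|B| ≤ 1`, a contradiction to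
Claim 9.»).  Hypotheses, in the vocabulary of the deep core of `conclusion_of_deepCore`:
`|A| ≥ |B| ≥ 4` (Claim 9), `|A + B| = |A| + |B|`, the maximality of `e` with `|B(e)| = 1` (`hmax`),
«`A` is not quasi-periodic» (Claim 4; the print quotes the stronger (47)), «`|N₁ᵃ(B, A)| ≤ 1` for all
`a ∈ A`» (Claim 8), «`A + B` is not quasi-periodic» ((45)).  See the module docstring for the one
deviation from the printed arithmetic ((57)–(60) replaced by Theorem 3.1 (iii) at the level `|B| − 1`).
[cite: Grynkiewicz2009, §6 Subcase 3 (pp. 31–32)] -/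
theorem subcaseThree_false {A B : Finset G} (hBA : #B ≤ #A) (hB4 : 4 ≤ #B)
    (hAB : #(A + B) = #A + #B)
    (hmax : ∀ x : G, ¬ (x +ᵥ B ⊆ A) → #(A ∩ (x +ᵥ B)) ≤ 1)
    (hAqp : ¬ IsQuasiPeriodic A) (hN1 : ∀ a ∈ A, #(layerWith B A 1 {a}) ≤ 1)
    (hABqp : ¬ IsQuasiPeriodic (A + B)) : False := by
  have hBne : B.Nonempty := card_pos.1 (by omega)
  obtain ⟨b₀, hb₀⟩ := id hBne
  -- «Let `T` be the subset of `A − B` such that `T + B ⊆ A`.»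
  set T : Finset G := (A - B).filter (fun x => x +ᵥ B ⊆ A) with hTdef
  have hTmem : ∀ x : G, x +ᵥ B ⊆ A → x ∈ T := by
    intro x hx
    rw [hTdef, mem_filter]
    exact ⟨mem_sub.2 ⟨x + b₀, hx (mem_vadd_finset.2 ⟨b₀, hb₀, rfl⟩), b₀, hb₀,
      add_sub_cancel_right x b₀⟩, hx⟩
  have hTsub : ∀ x ∈ T, x +ᵥ B ⊆ A := by
    intro x hx
    rw [hTdef, mem_filter] at hx
    exact hx.2
  have hTB : T + B ⊆ A := by
    intro z hz
    obtain ⟨x, hx, b, hb, rfl⟩ := mem_add.1 hz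
    exact hTsub x hx (mem_vadd_finset.2 ⟨b, hb, rfl⟩)
  -- «`|A′| ≤ 1`», where `A′ = A ∖ (T + B)`; hence `T ≠ ∅`
  have hA' : #(A \ (T + B)) ≤ 1 := card_sdiff_tset_add_le_one hmax hTmem hTB (by omega) hAB
  have hTne : T.Nonempty := by
    rw [nonempty_iff_ne_empty]
    rintro hT0
    rw [hT0, empty_add, sdiff_empty] at hA'
    omega
  have hTBne : (T + B).Nonempty := hTne.add hBne
  -- «it follows that `T + B` is aperiodic»
  have haperTB : (T + B).addStab = {0} := addStab_eq_of_card_sdiff_le_one hTB hA' hTBne hAqp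
  -- «Consequently, `B` is a Sidon set and `|2B| = |B|(|B| + 1)/2`»
  have hSidon := sidon_of_tset hmax hTmem hTsub hTne haperTB
  have h2B := card_mul_succ_le_two_mul_card_add_of_sidon hSidon
  -- «`T + 2B = (A + B) ∖ γ` … `T + 2B` is aperiodic»
  have hsub2 : T + (B + B) ⊆ A + B := by
    rw [← add_assoc]
    exact add_subset_add_right hTB
  have hD : #((A + B) \ (T + (B + B))) ≤ 1 := by
    rw [← add_assoc]
    rcases (A \ (T + B)).eq_empty_or_nonempty with h0 | hne
    · rw [subset_antisymm hTB (sdiff_eq_empty_iff_subset.1 h0), sdiff_self]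
      exact Nat.zero_le _
    · obtain ⟨α, hα⟩ := card_eq_one.1 (le_antisymm hA' (card_pos.2 hne))
      have hαA : α ∈ A := (mem_sdiff.1 (hα ▸ mem_singleton_self α)).1
      have hTBeq : T + B = A.erase α := by
        rw [← Finset.sdiff_sdiff_eq_self hTB, hα, sdiff_singleton_eq_erase]
      rw [hTBeq]
      exact card_add_sdiff_erase_add_le_one hαA (hN1 α hαA)
  have hT2Bne : (T + (B + B)).Nonempty := hTne.add (hBne.add hBne)
  have haper2 : (T + (B + B)).addStab = {0} :=
    addStab_eq_of_card_sdiff_le_one hsub2 hD hT2Bne hABqp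
  -- Kneser: «`|A| + |B| ≥ |T + 2B| ≥ |T| + |2B| − 1`»
  have hkn := card_add_card_le_card_add_add_card_addStab T (B + B) hTne (hBne.add hBne)
  rw [haper2, card_singleton] at hkn
  have hle : #(T + (B + B)) ≤ #(A + B) := card_le_card hsub2
  -- Theorem 3.1 (iii) with `k = 1`, at the level `d = |B| − 1`: `|T| ≥ |A| − |B|`
  have hTA : #T ≤ #A := (card_le_card_add_right hBne).trans (card_le_card hTB)
  have hrep : ∀ x ∉ T, A.addConvolution (-B) x ≤ 1 :=
    addConvolution_neg_le_of_card_inter_vadd_le fun x hx => hmax x fun h => hx (hTmem x h)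
  have hiii := thm31_iii A B T 1 (by omega) hTA hrep (#B - 1)
  simp only [Nat.div_one, one_pow, mul_one, Nat.mod_one, zero_pow two_ne_zero, add_zero] at hiii
  -- the arithmetic, in terms of `a = |A|`, `d = |B| − 1`, `t = |T|`, `s = |2B|`, `m = (|A| − |T|)|B|`
  obtain ⟨d, hd⟩ : ∃ d, #B = d + 1 := ⟨#B - 1, by omega⟩
  have hd1 : #B - 1 = d := by omega
  rw [hd1] at hiii
  set a := #A with ha
  set t := #T with ht
  set s := #(B + B) with hs
  have htb : t * #B ≤ a * #B := Nat.mul_le_mul_right #B hTA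
  obtain ⟨m, hm⟩ : ∃ m, t * #B + m = a * #B := ⟨a * #B - t * #B, Nat.add_sub_of_le htb⟩
  have hm' : a * #B - t * #B = m := by omega
  rw [hm', hAB] at hiii
  rw [hd] at hiii hm hB4 hBA hAB h2B
  have hd3 : 3 ≤ d := by omega
  -- (iii) at the level `d = |B| − 1` gives `a ≤ t + b`
  have hat : a ≤ t + (d + 1) := by
    by_contra hcon
    push Not at hcon
    have P := Nat.mul_le_mul_right (d * (d + 1)) hcon
    have Q := Nat.mul_le_mul hd3 (Nat.succ_le_succ hd3)
    nlinarith [hiii, hm, P, Q]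
  -- Kneser and the Sidon count: `2t + (d + 1)(d + 2) ≤ 2t + 2s ≤ 2(a + d + 1) + 2`
  rw [hAB] at hle
  have R := Nat.mul_le_mul_right d hd3
  nlinarith [hkn, hle, h2B, hat, R]

end Literature.Combinatorics.Additive.Grynkiewicz2009
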